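import Summits.ResolutionOfSingularities.ResolutionOfSingularities.Theorems.LightCutLaw2
import Summits.ResolutionOfSingularities.ResolutionOfSingularities.Theorems.RadicialJungCleanModelsStubLeibnizObstruction
import Mathlib.Algebra.MvPolynomial.PDeriv
import HarnessLib

/-!
# LightCutCells — decomp-res node «LightCut» (lens-6 g22, critic row 166), tree file 3/3 of the node

Content VERBATIM from the decomp-res lens-6 g22 node `HOME/decomp-res-lens-6/g22/LightCut.lean` rev 1 (pin 61988fc1;
= CLEARED rev 0 `4c811963` + hygiene h1;
HOME = run/shared/lean/pub/decomp-res; critic row 166 CLEARED DECIDED +1 · MAP 0; landing orders INBOX :684 / :690)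
— provenance, critic text and the lens header
in full in the first file of the node, `LightCutLaw`.  Namespace `…Theorems.LightCutClasses`; `--supports
stmt-ResolutionOfSingularities-26971`; cone-free.

## This file

§4 TAIL (carried here, cut from `LightCutLaw2` by the 400-line cap; same `section GeneralElimination` replayed):
`wildFinite_of_orderUSC'`, `wildElimination_of_nearPointFree`.  Then §5–§6 of the node (22 declarations): §5 THE
CELLS `TopHeavy`, `topNonSplit_of_topHeavy`, `WORTopHeavy` [RESIDUAL], `WORTopNonSplitLight` [DECIDED],
**`E1TopHeavy`** (THE LOCATED RESIDUAL — the ONE successor aside on the lens-6 column of `MaxContactCut`,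
SUPERSEDING rev 47's `TCE1TopNonSplit`; this module is its cone-free home), `E1TopNonSplitLight`; the EXACT hyp-free
carve `worTopNonSplit_iff_heavy_light` / `e1TopNonSplit_iff_heavy_light`; the decided chain
`worTopNonSplitLight_of_orderUSC` / `worTopNonSplitLight_of_allAbs` / `e1TopNonSplitLight_of_five` (tree
`orderUSC_holds`, `baseStable_holds`); the re-location **`e1TopNonSplit_iff_e1TopHeavy`**,
`e1TopNoAbs_iff_e1TopHeavy`, **`e_one_iff_e1TopHeavy (hSC : SubfieldContactAbs) (h5 : E 5) : E 1 ↔ E1TopHeavy`**,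
`e_one_of_heavy`; §5b the 0-priced PRINCIPALITY carve (`PrincipalAt`, `TopHeavyNonPrincipal`,
`topHeavy_of_topHeavyNonPrincipal`, `WORTopHeavyNonPrincipal` / `WORTopHeavyPrincipal`, `E1TopHeavyNonPrincipal` /
`E1TopHeavyPrincipal`, `worTopHeavy_iff_nonPrincipal_principal`, `e1TopHeavy_iff_nonPrincipal_principal` —
bookkeeping, NOT filed as items); §6 INHABITANT CERTIFICATES at polynomial level (`pderiv_fermat_layer`,
**`light_fermat`** (decided side: the Fermat layer is light for `p ≥ 3`), **`heavy_quartic`** (residual side: `z³ +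
t⁴ + u²w²` over `𝔽₃`, chart `u`), `light_two_iff` (DELIMITER: at `n = 2`, `d ≥ 3` the light cell is empty)).  The h1
hygiene of row 166 (the `u`-chart controlled transform of `z³ + t⁴ + u²w²` is `z′³ + u·w′² + u·t′⁴ = z′³ + u (w′² +
t′⁴)`, `t⁴ = u⁴t′⁴ ↦ u t′⁴`) is the lens's rev 1, landed as such.  Imports `LightCutLaw2` +
`Mathlib.Algebra.MvPolynomial.PDeriv` (used by §6 only) + tree
`Theorems/RadicialJungCleanModelsStubLeibnizObstruction` (DEDUP, gate `dedup.landed` p803637: the lens's two-line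
Leibniz helper `derivation_sq_mem` restates the landed `RadicialJung.CleanModels.derivation_apply_mem_of_mem_sq` —
the copy is dropped and its one use site in `light_fermat` cites the landed theorem by full name).

[WRITER NOTE (decomp-res writer g10): file split only (tree files ≤ 400 lines); namespace, universe, sections,
section variables / opens and every
declaration exactly as in the lens (the lens's global dupNamespace-linter line is dropped — the library sets it;
`set_option … in` prefixes of single declarations are kept).]

(Sources: Hironaka 1967 (characteristic polyhedra); CossartJannsenSaito2020 Def. 3.13 / Thm. 3.14 (p. 129) / Thm.
9.6 (p. 136); CossartPiltant2008 §2; Giraud1975; EGAIV4 §16; StacksProject 0804 / 0BIQ; DeJong1996 2.4;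
ZariskiSamuel1960 VIII §1; Matsumura1987 §14/§17.)
-/

noncomputable section

open CategoryTheory AlgebraicGeometry TopologicalSpace IsLocalRing
open Literature.AlgebraicGeometry.Resolution

universe u

namespace Summit.ResolutionOfSingularities.ResolutionOfSingularities.Theorems.LightCutClasses

open Summit.ResolutionOfSingularities.ResolutionOfSingularities.Theorems.TwistCutClasses

section GeneralElimination

open Summit.ResolutionOfSingularities.ResolutionOfSingularities.Theorems
open WeakOrderReduction ForcedTowerClasses SubfieldContactClasses AbsoluteContactClasses PurityValveClasses
open Scheme.IdealSheafData (vanishingIdeal)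
variable {Y Y' : Scheme.{0}} {π : Y' ⟶ Y} {C : Y.IdealSheafData}

/-- **FINITENESS of the `P`-wild set** (PROVED modulo `OrderUSC`, `BaseStable`): if every wild closed top point satisfies the
near-point-free predicate `P`, there are finitely many. [folklore; tree `wildSplitFinite_of_orderUSC` abstracted] [folklore] -/
theorem wildFinite_of_orderUSC' {P : ∀ ⦃Y : Scheme.{0}⦄, Y.IdealSheafData → Y → Prop} {n : ℕ} (hP : NearPointFree n P)
    (hU : OrderUSC) (hBS : BaseStable) {k : Type} [Field k] {Y : Scheme.{0}} {g : Y ⟶ Spec (.of k)} (hB : IsBase Y g)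
    {M : MarkedIdeal Y} (hM : IsDatum n M) (hsplit : ∀ y ∈ wildSet M n, P M.ideal y) : (wildSet M n).Finite := by
  haveI := hB.locallyOfFiniteType
  haveI : IsLocallyNoetherian Y := LocallyOfFiniteType.isLocallyNoetherian g
  haveI := hB.quasiCompact
  haveI : CompactSpace Y := QuasiCompact.compactSpace_of_compactSpace g
  haveI : IsNoetherian Y := {}
  have hTc : IsClosed (M.support : Set Y) := by
    show IsClosed {x | (M.mult : ℕ∞) ≤ idealOrder M.ideal x}
    rw [hM.1]; exact hU k Y g hB M.ideal n
  obtain ⟨S, hSf, hSc, hSi, hSU⟩ := NoetherianSpace.exists_finite_set_isClosed_irreducible hTc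
  refine Set.Finite.of_finite_image (f := fun y : Y => ({y} : Set Y)) (hSf.subset ?_) Set.singleton_injective.injOn
  rintro _ ⟨y₀, hy₀, rfl⟩
  have hy₀T : y₀ ∈ M.support := by
    show (M.mult : ℕ∞) ≤ idealOrder M.ideal y₀
    rw [hM.1, hy₀.2.1]
  rw [hSU] at hy₀T
  obtain ⟨Z, hZS, hy₀Z⟩ := Set.mem_sUnion.mp hy₀T
  have hZT : Z ⊆ M.support := by rw [hSU]; exact Set.subset_sUnion_of_mem hZS
  have hZeq := eq_singleton_of_isIrreducible' hU hBS hB hM hy₀.1 (hP.1 hB.isRegular M hM.1 hy₀.1 (hsplit y₀ hy₀))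
    (hSi Z hZS) (hSc Z hZS) hZT hy₀Z
  show ({y₀} : Set Y) ∈ S
  rw [← hZeq]; exact hZS

/-- **ELIMINATION of the `P`-wild points** (PROVED modulo `OrderUSC`, `BaseStable`): if every wild closed top point of a
datum satisfies a near-point-free predicate `P`, finitely many point blow-ups empty the wild set, keeping `IsDatum n` and
the base class. [new] [folklore] -/
theorem wildElimination_of_nearPointFree {P : ∀ ⦃Y : Scheme.{0}⦄, Y.IdealSheafData → Y → Prop} {n : ℕ}
    (hP : NearPointFree n P) (hU : OrderUSC) (hBS : BaseStable) {k : Type} [Field k] {Y : Scheme.{0}}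
    {g : Y ⟶ Spec (.of k)} (hB : IsBase Y g) {M : MarkedIdeal Y} (hM : IsDatum n M)
    (hsplit : ∀ y ∈ wildSet M n, P M.ideal y) :
    ∃ t : CentreSeq Y, WeakAdmissible t M ∧ ∃ _ : IsBase t.top (t.comp ≫ g),
      IsDatum n (t.transformMarked M) ∧ wildSet (t.transformMarked M) n = ∅ :=
  elimination_aux' hP hBS _ Y g hB M hM (wildFinite_of_orderUSC' hP hU hBS hB hM hsplit) le_rfl hsplit

end GeneralElimination

section Cells

open Summit.ResolutionOfSingularities.ResolutionOfSingularities.Theorems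
open WeakOrderReduction ForcedTowerClasses SubfieldContactClasses AbsoluteContactClasses PurityValveClasses

/-! ## §5 THE CELLS, THE EXACT RE-LOCATION, THE DECIDED CHAIN -/

/-- **`TopHeavy Y 𝓘 n` — A HEAVY WILD CLOSED TOP POINT EXISTS**: a closed point of order exactly `n`, without absolute
stalk contact, NOT differentially split and NOT light. DEFINITION (residual locus). -/
def TopHeavy (Y : Scheme.{0}) (I : Y.IdealSheafData) (n : ℕ) : Prop :=
  ∃ y : Y, IsClosed ({y} : Set Y) ∧ idealOrder I y = ((n : ℕ) : ℕ∞) ∧ ¬ IsAbsContactAt I n y ∧ ¬ DiffSplitAt I n y ∧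
    ¬ LightAt I n y

/-- A heavy point is a non-split wild point. [folklore] -/
theorem topNonSplit_of_topHeavy {Y : Scheme.{0}} {I : Y.IdealSheafData} {n : ℕ} (h : TopHeavy Y I n) :
    TopNonSplit Y I n := by
  obtain ⟨y, hc, ho, hna, hns, -⟩ := h
  exact ⟨y, hc, ho, hna, hns⟩

/-- **THE RESIDUAL CELL · `WORTopHeavy n`** — weak resolution for the base data at marking `n` having a HEAVY wild closed top
point. RESIDUAL. -/
def WORTopHeavy (n : ℕ) : Prop :=
  ∀ p : ℕ, p.Prime → ∀ (k : Type) [Field k] [CharP k p] (Y : Scheme.{0}) (g : Y ⟶ Spec (.of k)),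
    IsBase Y g → ∀ M : MarkedIdeal Y, IsDatum n M → TopHeavy Y M.ideal n →
      ∃ t : CentreSeq Y, WeakResolution t M

/-- **THE DECIDED CELL · `WORTopNonSplitLight n`** — the data of the g21 residual `TopNonSplit` all of whose non-split wild
closed top points are LIGHT (no heavy point). DECIDED (PROVED below from the tree: `orderUSC_holds`, `baseStable_holds`,
`SubfieldContactAbs`, `E 5`). -/
def WORTopNonSplitLight (n : ℕ) : Prop :=
  ∀ p : ℕ, p.Prime → ∀ (k : Type) [Field k] [CharP k p] (Y : Scheme.{0}) (g : Y ⟶ Spec (.of k)),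
    IsBase Y g → ∀ M : MarkedIdeal Y, IsDatum n M → TopNonSplit Y M.ideal n → ¬ TopHeavy Y M.ideal n →
      ∃ t : CentreSeq Y, WeakResolution t M

/-- **THE RESIDUAL (family) · `E1TopHeavy`** — THE LOCATED RESIDUAL of the lens-6 column after g22: the ONE successor aside
superseding `E1TopNonSplit`. RESIDUAL. -/
def E1TopHeavy : Prop := ∀ n : ℕ, 1 ≤ n → WORTopHeavy n

/-- **THE DECIDED family · `E1TopNonSplitLight`**. DECIDED. -/
def E1TopNonSplitLight : Prop := ∀ n : ℕ, 1 ≤ n → WORTopNonSplitLight n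

/-- **EXACT CARVE at one marking** (hypothesis-free): `WORTopNonSplit n ⟺ WORTopHeavy n ∧ WORTopNonSplitLight n`
(excluded middle on `TopHeavy`). [folklore] -/
theorem worTopNonSplit_iff_heavy_light (n : ℕ) : WORTopNonSplit n ↔ WORTopHeavy n ∧ WORTopNonSplitLight n := by
  constructor
  · intro h
    exact ⟨fun p hp k _ _ Y g hB M hM hH => h p hp k Y g hB M hM (topNonSplit_of_topHeavy hH),
      fun p hp k _ _ Y g hB M hM hN _ => h p hp k Y g hB M hM hN⟩
  · rintro ⟨hH, hL⟩ p hp k _ _ Y g hB M hM hN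
    by_cases hh : TopHeavy Y M.ideal n
    · exact hH p hp k Y g hB M hM hh
    · exact hL p hp k Y g hB M hM hN hh

/-- **EXACT RE-LOCATION (family, hypothesis-free)**: `E1TopNonSplit ⟺ E1TopHeavy ∧ E1TopNonSplitLight`. [folklore] -/
theorem e1TopNonSplit_iff_heavy_light : E1TopNonSplit ↔ E1TopHeavy ∧ E1TopNonSplitLight := by
  constructor
  · intro h
    exact ⟨fun n hn => ((worTopNonSplit_iff_heavy_light n).1 (h n hn)).1,
      fun n hn => ((worTopNonSplit_iff_heavy_light n).1 (h n hn)).2⟩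
  · rintro ⟨hH, hL⟩ n hn
    exact (worTopNonSplit_iff_heavy_light n).2 ⟨hH n hn, hL n hn⟩

/-- **THE DECIDED CELL modulo the two standard tree theorems and the tame side** (PROVED): `OrderUSC → BaseStable →
WORAllAbs n → WORTopNonSplitLight n`.  Every wild closed top point of a datum of the cell is split or light, hence
near-point-free; the generalised elimination empties the wild set; the tame engine resolves the transform. [new] [folklore] -/
theorem worTopNonSplitLight_of_orderUSC (hU : OrderUSC) (hBS : BaseStable) {n : ℕ} (hn : 1 ≤ n) (hA : WORAllAbs n) :
    WORTopNonSplitLight n := by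
  intro p hp k _ _ Y g hB M hM _ hnh
  have hP : ∀ y ∈ wildSet M n, DiffSplitAt M.ideal n y ∨ LightAt M.ideal n y := by
    intro y hy
    by_contra h
    exact hnh ⟨y, hy.1, hy.2.1, hy.2.2, fun hs => h (Or.inl hs), fun hl => h (Or.inr hl)⟩
  obtain ⟨t, hadm, hB', hM', hempty⟩ :=
    wildElimination_of_nearPointFree (nearPointFree_splitOrLight hn) hU hBS hB hM hP
  have hno : ¬ TopNoAbsContact t.top (t.transformMarked M).ideal n := by
    rw [topNoAbsContact_iff_wildSet_nonempty, hempty]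
    exact Set.not_nonempty_empty
  obtain ⟨t', ht'⟩ := hA p hp k t.top (t.comp ≫ g) hB' (t.transformMarked M) hM' hno
  exact ⟨seqAppend t t', weakResolution_seqAppend t t' M hadm ht'⟩

/-- **THE DECIDED CELL (PROVED in kernel, the ports discharged by the tree)**: `WORAllAbs n → WORTopNonSplitLight n`.
[new] [folklore] -/
theorem worTopNonSplitLight_of_allAbs {n : ℕ} (hn : 1 ≤ n) (hA : WORAllAbs n) : WORTopNonSplitLight n :=
  worTopNonSplitLight_of_orderUSC orderUSC_holds baseStable_holds hn hA

/-- **THE DECIDED family under exactly the standing hypotheses `SubfieldContactAbs` (PROVED, g20) and `E 5`.** [new]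
[folklore] -/
theorem e1TopNonSplitLight_of_five (hSC : SubfieldContactAbs) (h5 : E 5) : E1TopNonSplitLight :=
  fun n hn => worTopNonSplitLight_of_allAbs hn (worAllAbs_of_five hSC hn (h5 n hn))

/-- **THE RE-LOCATION**: `SubfieldContactAbs → E 5 → (E1TopNonSplit ↔ E1TopHeavy)`. [new] [folklore] -/
theorem e1TopNonSplit_iff_e1TopHeavy (hSC : SubfieldContactAbs) (h5 : E 5) : E1TopNonSplit ↔ E1TopHeavy := by
  rw [e1TopNonSplit_iff_heavy_light]
  exact ⟨fun h => h.1, fun h => ⟨h, e1TopNonSplitLight_of_five hSC h5⟩⟩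

/-- **THE RE-LOCATION from item 26971's class**: `SubfieldContactAbs → E 5 → (E1TopNoAbs ↔ E1TopHeavy)`. [new] [folklore] -/
theorem e1TopNoAbs_iff_e1TopHeavy (hSC : SubfieldContactAbs) (h5 : E 5) : E1TopNoAbs ↔ E1TopHeavy :=
  (e1TopNoAbs_iff_e1TopNonSplit' hSC h5).trans (e1TopNonSplit_iff_e1TopHeavy hSC h5)

/-- **Summit edge**: `SubfieldContactAbs → E 5 → (E 1 ↔ E1TopHeavy)`. [new] [folklore] -/
theorem e_one_iff_e1TopHeavy (hSC : SubfieldContactAbs) (h5 : E 5) : E 1 ↔ E1TopHeavy :=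
  (e_one_iff_e1TopNonSplit hSC h5).trans (e1TopNonSplit_iff_e1TopHeavy hSC h5)

/-- `E 1` from the tame engine and the heavy residual. [new] [folklore] -/
theorem e_one_of_heavy (hSC : SubfieldContactAbs) (h5 : E 5) (hR : E1TopHeavy) : E 1 :=
  (e_one_iff_e1TopHeavy hSC h5).2 hR

end Cells

section Principal

open Summit.ResolutionOfSingularities.ResolutionOfSingularities.Theorems
open WeakOrderReduction ForcedTowerClasses SubfieldContactClasses AbsoluteContactClasses PurityValveClasses

/-! ## §5b BOOKKEEPING (priced 0): the heavy residual carved by PRINCIPALITY of the initial form (intrinsic typing) -/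

/-- **`PrincipalAt 𝓘 n y` — PRINCIPAL INITIAL FORM** (intrinsic, presentation-free): some `f ∈ 𝓘_y` has
`f ≡ a z^n (mod 𝔪_y^{n+1})` with `a` a unit and `z ∈ 𝔪_y ∖ 𝔪_y²` (i.e. `in_n f = ā Z̄^n` in `gr_𝔪 𝒪_y`, ONE parameter).
`NonPrincipal := ¬ PrincipalAt` (its negation alone).  DEFINITION (support; bookkeeping of the heavy residual). -/
def PrincipalAt {Y : Scheme.{0}} (I : Y.IdealSheafData) (n : ℕ) (y : Y) : Prop :=
  ∃ f ∈ stalkIdeal I y, ∃ a ∉ maximalIdeal (Y.presheaf.stalk y), ∃ z ∈ maximalIdeal (Y.presheaf.stalk y),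
    z ∉ maximalIdeal (Y.presheaf.stalk y) ^ 2 ∧ f - a * z ^ n ∈ maximalIdeal (Y.presheaf.stalk y) ^ (n + 1)

/-- A heavy wild closed top point with NON-principal initial form exists. DEFINITION (residual sub-locus). -/
def TopHeavyNonPrincipal (Y : Scheme.{0}) (I : Y.IdealSheafData) (n : ℕ) : Prop :=
  ∃ y : Y, IsClosed ({y} : Set Y) ∧ idealOrder I y = ((n : ℕ) : ℕ∞) ∧ ¬ IsAbsContactAt I n y ∧ ¬ DiffSplitAt I n y ∧
    ¬ LightAt I n y ∧ ¬ PrincipalAt I n y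

/-- [folklore] -/
theorem topHeavy_of_topHeavyNonPrincipal {Y : Scheme.{0}} {I : Y.IdealSheafData} {n : ℕ}
    (h : TopHeavyNonPrincipal Y I n) : TopHeavy Y I n := by
  obtain ⟨y, hc, ho, hna, hns, hnl, -⟩ := h
  exact ⟨y, hc, ho, hna, hns, hnl⟩

/-- **RESIDUAL sub-cell · `WORTopHeavyNonPrincipal n`**: data with a heavy wild closed top point of NON-principal initial
form (the imperfect-residue world of g21's (T2) analysis lives here, e.g. `z² + b t² + w² + u³` over `𝔽₂(b)`). RESIDUAL. -/
def WORTopHeavyNonPrincipal (n : ℕ) : Prop :=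
  ∀ p : ℕ, p.Prime → ∀ (k : Type) [Field k] [CharP k p] (Y : Scheme.{0}) (g : Y ⟶ Spec (.of k)),
    IsBase Y g → ∀ M : MarkedIdeal Y, IsDatum n M → TopHeavyNonPrincipal Y M.ideal n →
      ∃ t : CentreSeq Y, WeakResolution t M

/-- **RESIDUAL sub-cell · `WORTopHeavyPrincipal n`**: data with heavy wild closed top points ALL of principal initial form
(`in_n f = ā Z̄^n`; the scope of the ONE admissible closing law on this axis: the complete near-point criterion of the
characteristic polyhedron, Hironaka 1967 / CJS LNM 2270 Ch. 8). RESIDUAL. -/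
def WORTopHeavyPrincipal (n : ℕ) : Prop :=
  ∀ p : ℕ, p.Prime → ∀ (k : Type) [Field k] [CharP k p] (Y : Scheme.{0}) (g : Y ⟶ Spec (.of k)),
    IsBase Y g → ∀ M : MarkedIdeal Y, IsDatum n M → TopHeavy Y M.ideal n → ¬ TopHeavyNonPrincipal Y M.ideal n →
      ∃ t : CentreSeq Y, WeakResolution t M

/-- RESIDUAL (family). -/
def E1TopHeavyNonPrincipal : Prop := ∀ n : ℕ, 1 ≤ n → WORTopHeavyNonPrincipal n

/-- RESIDUAL (family). -/
def E1TopHeavyPrincipal : Prop := ∀ n : ℕ, 1 ≤ n → WORTopHeavyPrincipal n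

/-- **EXACT CARVE of the heavy cell by principality** (hypothesis-free, excluded middle on `TopHeavyNonPrincipal`).
[folklore] -/
theorem worTopHeavy_iff_nonPrincipal_principal (n : ℕ) :
    WORTopHeavy n ↔ WORTopHeavyNonPrincipal n ∧ WORTopHeavyPrincipal n := by
  constructor
  · intro h
    exact ⟨fun p hp k _ _ Y g hB M hM hH => h p hp k Y g hB M hM (topHeavy_of_topHeavyNonPrincipal hH),
      fun p hp k _ _ Y g hB M hM hH _ => h p hp k Y g hB M hM hH⟩
  · rintro ⟨hN, hP⟩ p hp k _ _ Y g hB M hM hH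
    by_cases hh : TopHeavyNonPrincipal Y M.ideal n
    · exact hN p hp k Y g hB M hM hh
    · exact hP p hp k Y g hB M hM hH hh

/-- **EXACT CARVE (family)**: `E1TopHeavy ⟺ E1TopHeavyNonPrincipal ∧ E1TopHeavyPrincipal`. [folklore] -/
theorem e1TopHeavy_iff_nonPrincipal_principal : E1TopHeavy ↔ E1TopHeavyNonPrincipal ∧ E1TopHeavyPrincipal := by
  constructor
  · intro h
    exact ⟨fun n hn => ((worTopHeavy_iff_nonPrincipal_principal n).1 (h n hn)).1,
      fun n hn => ((worTopHeavy_iff_nonPrincipal_principal n).1 (h n hn)).2⟩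
  · rintro ⟨hN, hP⟩ n hn
    exact (worTopHeavy_iff_nonPrincipal_principal n).2 ⟨hN n hn, hP n hn⟩

end Principal

section Certificates

open MvPolynomial
variable {K : Type*} [Field K]

/-- The partial derivative of the Fermat layer `1 + X_v^{p+1} + X_{v'}^{p+1}` in characteristic `p` is `X_v^p`.
[elementary] [folklore] -/
theorem pderiv_fermat_layer (p : ℕ) [CharP K p] {σ : Type*} {v v' : σ} (hvv' : v ≠ v') :
    pderiv v (1 + X v ^ (p + 1) + X v' ^ (p + 1) : MvPolynomial σ K) = X v ^ p := by
  classical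
  rw [map_add, map_add, Derivation.map_one_eq_zero, Derivation.leibniz_pow, Derivation.leibniz_pow, pderiv_X_self,
    pderiv_X_of_ne hvv'.symm, smul_zero, smul_zero, add_zero, zero_add, Nat.add_sub_cancel, smul_eq_mul, mul_one,
    succ_nsmul, nsmul_eq_mul, CharP.cast_eq_zero, zero_mul, zero_add]

/-- **DECIDED-SIDE KERNEL CERTIFICATE `light_fermat`** (inhabitant R1 = `z^p + t^{p+1} + u^{p+1} + w^{p+1}` over `𝔽_p`,
`p ≥ 3`; chart `t`: reduced layer `Ḡ₁ = 1 + U^{p+1} + W^{p+1}`, and symmetrically in the charts `u`, `w`): for EVERY prime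
`𝔮` of `K[...]` (char `p ≥ 3`) and every `s ∉ 𝔮`, `s · (1 + X_u^{p+1} + X_w^{p+1}) ∉ 𝔮^{p-1}` — the layer is LIGHT
(indeed smooth: `∂_u = X_u^p`, `∂_w = X_w^p`).  [new; elementary] [folklore] -/
theorem light_fermat (p : ℕ) [CharP K p] (h3 : 3 ≤ p) {σ : Type*} {u w : σ} (huw : u ≠ w)
    (𝔮 : Ideal (MvPolynomial σ K)) [h𝔮 : 𝔮.IsPrime] {s : MvPolynomial σ K} (hs : s ∉ 𝔮) :
    s * (1 + X u ^ (p + 1) + X w ^ (p + 1)) ∉ 𝔮 ^ (p - 1) := by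
  classical
  intro hmem
  have h2 : s * (1 + X u ^ (p + 1) + X w ^ (p + 1)) ∈ 𝔮 ^ 2 := Ideal.pow_le_pow_right (by omega) hmem
  have h1 : s * (1 + X u ^ (p + 1) + X w ^ (p + 1)) ∈ 𝔮 := Ideal.pow_le_self two_ne_zero h2
  have hφ : (1 + X u ^ (p + 1) + X w ^ (p + 1) : MvPolynomial σ K) ∈ 𝔮 := (h𝔮.mem_or_mem h1).resolve_left hs
  -- `X_v ∈ 𝔮` for `v = u, w`, by differentiating `s φ ∈ 𝔮²`
  have key : ∀ (v v' : σ), v ≠ v' → (1 + X v ^ (p + 1) + X v' ^ (p + 1) : MvPolynomial σ K) ∈ 𝔮 →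
      s * (1 + X v ^ (p + 1) + X v' ^ (p + 1)) ∈ 𝔮 ^ 2 → (X v : MvPolynomial σ K) ∈ 𝔮 := by
    intro v v' hvv' hφ' h2'
    have hD := Summit.ResolutionOfSingularities.ResolutionOfSingularities.Theorems.RadicialJung.CleanModels.derivation_apply_mem_of_mem_sq (pderiv v) 𝔮 h2'
    rw [Derivation.leibniz, pderiv_fermat_layer p hvv', smul_eq_mul, smul_eq_mul] at hD
    have h3' : s * X v ^ p ∈ 𝔮 := by
      have := sub_mem hD (𝔮.mul_mem_right (pderiv v s) hφ')
      rwa [add_sub_cancel_right] at this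
    exact h𝔮.mem_of_pow_mem p ((h𝔮.mem_or_mem h3').resolve_left hs)
  have hXu : (X u : MvPolynomial σ K) ∈ 𝔮 := key u w huw hφ h2
  have hXw : (X w : MvPolynomial σ K) ∈ 𝔮 := by
    refine key w u (Ne.symm huw) ?_ ?_
    · rw [add_right_comm]; exact hφ
    · rw [add_right_comm]; exact h2
  have h1mem : (1 : MvPolynomial σ K) ∈ 𝔮 := by
    have := sub_mem (sub_mem hφ (𝔮.pow_mem_of_mem hXu (p + 1) (by omega))) (𝔮.pow_mem_of_mem hXw (p + 1) (by omega))
    rwa [show (1 + X u ^ (p + 1) + X w ^ (p + 1) - X u ^ (p + 1) - X w ^ (p + 1) : MvPolynomial σ K) = 1 by ring]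
      at this
  exact h𝔮.ne_top ((Ideal.eq_top_iff_one _).2 h1mem)

/-- **RESIDUAL-SIDE KERNEL CERTIFICATE `heavy_quartic`** (inhabitant `z³ + t⁴ + u²w²` over `𝔽₃`, chart `u`: reduced layer
`Ḡ₁ = T⁴ + W²` in `K[Z, T, W]`): at the prime `𝔮 = (Z, T, W)` (kernel of evaluation at `0`, containing `Z = X 0`) one has
`1 ∉ 𝔮` and `1 · (T⁴ + W²) ∈ 𝔮² = 𝔮^{n-1}` (`n = 3`) — the point is NOT light in chart `u` (and it is a near point there:
`z′³ + u (w′² + t′⁴)` has order `3`).  [new; elementary] [folklore] -/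
theorem heavy_quartic (K : Type*) [Field K] :
    (RingHom.ker (MvPolynomial.eval (0 : Fin 3 → K))).IsPrime ∧
      (X 0 : MvPolynomial (Fin 3) K) ∈ RingHom.ker (MvPolynomial.eval (0 : Fin 3 → K)) ∧
      (1 : MvPolynomial (Fin 3) K) ∉ RingHom.ker (MvPolynomial.eval (0 : Fin 3 → K)) ∧
      (1 : MvPolynomial (Fin 3) K) * (X 1 ^ 4 + X 2 ^ 2) ∈ RingHom.ker (MvPolynomial.eval (0 : Fin 3 → K)) ^ (3 - 1) := by
  have hX : ∀ i : Fin 3, (X i : MvPolynomial (Fin 3) K) ∈ RingHom.ker (MvPolynomial.eval (0 : Fin 3 → K)) := fun i => by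
    rw [RingHom.mem_ker, eval_X, Pi.zero_apply]
  refine ⟨RingHom.ker_isPrime _, hX 0, ?_, ?_⟩
  · rw [RingHom.mem_ker, map_one]; exact one_ne_zero
  · rw [one_mul, show (3 - 1 : ℕ) = 2 from rfl, pow_two]
    refine Ideal.add_mem _ ?_ ?_
    · rw [show (X 1 : MvPolynomial (Fin 3) K) ^ 4 = X 1 ^ 3 * X 1 by ring]
      exact Ideal.mul_mem_mul (Ideal.pow_mem_of_mem _ (hX 1) 3 (by norm_num)) (hX 1)
    · rw [pow_two]
      exact Ideal.mul_mem_mul (hX 2) (hX 2)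

/-- **DELIMITER (n = 2)**: at marking `n = 2` a layer is light iff the reduced cubic misses EVERY prime `𝔮 ∋ Z̄` of every
chart (`𝔮^{n-1} = 𝔮`), i.e. iff the cubic form `Ḡ|_{Z̄ = 0}` has NO zero on `ℙ^{d-2}_{κ(y)}`.  For embedding dimension
`d ≥ 3` a cubic form in `≥ 2` variables always has a zero on `ℙ^{d-2}` (a hypersurface of `ℙ^{≥ 1}` is non-empty), so the
light cell is EMPTY at `n = 2`, `d ≥ 3`; for `d = 2` (plane curves) it reads «the coefficient of `c_i³` is a unit» and only
re-proves that the wild cusp `z² + (unit)·t³ + …` is resolved by one point blow-up.  Hence the increment of this node rests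
on `n = p ≥ 3` (surfaces in ambient dimension `≥ 3` onwards).  Recorded as the trivial unfolding.  [elementary] [folklore] -/
theorem light_two_iff {A : Type*} [CommRing A] (𝔮 : Ideal A) (G s : A) :
    (s * G ∉ 𝔮 ^ (2 - 1)) ↔ s * G ∉ 𝔮 := by
  rw [show (2 - 1 : ℕ) = 1 from rfl, pow_one]

end Certificates

end Summit.ResolutionOfSingularities.ResolutionOfSingularities.Theorems.LightCutClasses
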